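import Summits.CriticalPhenomena.PercolationContinuityZ3.Theses.PercNecklaceBackbone
import Literature.Probability.Percolation.HalfSpaceStar
import HarnessLib

/-!
# Route PercNecklaceBackbone — `BackboneAboveSurfaceSq` (stmt-CriticalPhenomena-10380)

The easy half of the Chayes–Chayes backbone sandwich (Chayes–Chayes 1986, Thm. 4.4, vertex form;
Grimmett, *Percolation*, 2nd ed. 1999, §13.2): for every `p ∈ [0, 1]`,

  `p · θ_ℍ(p)² ≤ Q(p) := P_p{ω | for every edge e, the origin still percolates in ω ∖ {e}}`,

where `θ_ℍ(p) = theta ((zdGraph 3).induce {x | 0 ≤ x 0}) ⟨0, _⟩ p` is the percolation probability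
of the induced half-space `ℍ = {0 ≤ x₀}` of `ℤ³` at its boundary origin (definitionally
`theta (halfSpaceGraph 3) (halfSpaceOrigin 3) p` of `HalfSpace.lean`).

Proof (two independent routes to infinity). Let `e₀ = (1,0,0) = BGN.up`,
`A = {0 ↔ ∞ in {x₀ ≤ 0}}`, `E = {⟨0, e₀⟩ open}` and `B = {e₀ ↔ ∞ in {1 ≤ x₀}}` (constrained
percolation events `percolatesVia (withinGraph (zdGraph 3) ·)`, `ConstrainedClusters.lean`). The
three events are determined by pairwise disjoint edge sets, hence independent
(`bondPercolation_real_inter_of_disjoint`); `P_p(E) = p` (`bondPercolation_cylinder`),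
`P_p(B) = θ_ℍ(p)` by the translation `x ↦ x + e₀` (`BGN.real_percolatesVia_upperHalfSpace_up`) and
`P_p(A) = θ_ℍ(p)` by the point reflection `x ↦ -x` of `ℤ³`
(`bondPercolation_real_preimage_relabel_iso`, `relabel_preimage_percolatesVia`,
`theta_induce_eq_real_percolatesVia`). On `A ∩ E ∩ B` closing a single edge `e` leaves one of the
two routes intact: if `e` is a lattice step inside `{x₀ ≤ 0}` then the open edge `⟨0, e₀⟩` followed
by the infinite path of `B` survives, otherwise the infinite path of `A` does. Hence
`p · θ_ℍ(p)² = P_p(A ∩ E ∩ B) ≤ Q(p)`.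
-/

noncomputable section

namespace Summit.CriticalPhenomena.PercolationContinuityZ3.Theorems

open MeasureTheory Literature.Probability.Percolation Literature.Probability.LatticeModels

/-- Closing an edge outside `S` does not change the trace of a configuration on `S`:
`(ω ∖ {e}) ∩ S = ω ∩ S` for `e ∉ S`. -/
private theorem diff_singleton_inter_eq_of_notMem {α : Type*} {ω S : Set α} {e : α} (he : e ∉ S) :
    (ω \ {e}) ∩ S = ω ∩ S := by
  ext f
  simp only [Set.mem_inter_iff, Set.mem_sdiff, Set.mem_singleton_iff]
  constructor
  · rintro ⟨⟨hf, -⟩, hfS⟩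
    exact ⟨hf, hfS⟩
  · rintro ⟨hf, hfS⟩
    exact ⟨⟨hf, fun h => he (h ▸ hfS)⟩, hfS⟩

/-- An event determined by the edge set `S` is stable under closing one edge outside `S`. -/
private theorem diff_singleton_mem_of_determinedBy {α : Type*} {A : Set (Set α)} {S : Set α}
    (hA : DeterminedBy A S) {ω : Set α} {e : α} (he : e ∉ S) (hω : ω ∈ A) : ω \ {e} ∈ A :=
  ((determinedBy_iff A S).1 hA (ω \ {e}) ω (diff_singleton_inter_eq_of_notMem he)).2 hω

/-- The point reflection `x ↦ -x` preserves adjacency in the nearest-neighbour graph `ℤ³`. -/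
private theorem zdGraph_adj_neg_iff (a b : Site 3) :
    (zdGraph 3).Adj (-a) (-b) ↔ (zdGraph 3).Adj a b := by
  rw [zdGraph_adj_iff, zdGraph_adj_iff]
  refine exists_congr fun i => ?_
  rw [or_comm]
  refine or_congr ⟨fun h => ?_, fun h => ?_⟩ ⟨fun h => ?_, fun h => ?_⟩
  · linear_combination h
  · linear_combination h
  · linear_combination h
  · linear_combination h

/-- **`P_p(0 ↔ ∞ in {x₀ ≤ 0}) = θ_ℍ(p)`**: the point reflection `x ↦ -x` is an automorphism of `ℤ³`
fixing the origin and carrying `ℍ = {0 ≤ x₀}` onto the lower half-space `{x₀ ≤ 0}`; bond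
percolation is invariant under it, and `θ_ℍ(p) = P_p(0 ↔ ∞ in ℍ)`
(`theta_induce_eq_real_percolatesVia`). -/
private theorem real_percolatesVia_lowerHalfSpace (p : unitInterval) :
    (bondPercolation (zdGraph 3) p).real
        (percolatesVia (withinGraph (zdGraph 3) {x : Site 3 | x 0 ≤ 0}) (0 : Site 3)) =
      theta (halfSpaceGraph 3) (halfSpaceOrigin 3) p := by
  have hK : ∀ u v : Site 3,
      (withinGraph (zdGraph 3) {x : Site 3 | x 0 ≤ 0}).Adj (Equiv.neg (Site 3) u) (Equiv.neg (Site 3) v) ↔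
        (withinGraph (zdGraph 3) (halfSpace 3)).Adj u v := by
    intro u v
    have hz : (zdGraph 3).Adj (-u) (-v) ↔ (zdGraph 3).Adj u v := zdGraph_adj_neg_iff u v
    simp only [withinGraph_adj, Equiv.neg_apply, hz, Set.mem_setOf_eq, Pi.neg_apply, neg_nonpos,
      BGN.mem_halfSpace_iff]
  -- reflection carries `{0 ↔ ∞ in ℍ}` to `{0 ↔ ∞ in {x₀ ≤ 0}}`
  have h1 : BondConfig.relabel (sym2Equiv (Equiv.neg (Site 3))) ⁻¹'
        percolatesVia (withinGraph (zdGraph 3) {x : Site 3 | x 0 ≤ 0}) (0 : Site 3) =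
      percolatesVia (withinGraph (zdGraph 3) (halfSpace 3)) (0 : Site 3) := by
    have h := relabel_preimage_percolatesVia (Equiv.neg (Site 3)) hK 0
    rwa [show (Equiv.neg (Site 3)) (0 : Site 3) = 0 from neg_zero] at h
  -- and bond percolation on `ℤ³` is reflection invariant
  have h2 : (bondPercolation (zdGraph 3) p).real (BondConfig.relabel (sym2Equiv (Equiv.neg (Site 3))) ⁻¹'
        percolatesVia (withinGraph (zdGraph 3) {x : Site 3 | x 0 ≤ 0}) (0 : Site 3)) =
      (bondPercolation (zdGraph 3) p).real
        (percolatesVia (withinGraph (zdGraph 3) {x : Site 3 | x 0 ≤ 0}) (0 : Site 3)) :=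
    bondPercolation_real_preimage_relabel_iso (G := zdGraph 3) (G' := zdGraph 3)
      { toEquiv := Equiv.neg (Site 3), map_rel_iff' := fun {a b} => zdGraph_adj_neg_iff a b } p _
  rw [← h2, h1]
  exact (BGN.theta_halfSpace_eq_real_percolatesVia p).symm

/-- The lattice steps inside the lower half-space `{x₀ ≤ 0}` are disjoint from the edge `⟨0, e₀⟩`
and from the steps inside the shifted half-space `{1 ≤ x₀}`. -/
private theorem disjoint_edgeSet_lowerHalfSpace :
    Disjoint (withinGraph (zdGraph 3) {x : Site 3 | x 0 ≤ 0}).edgeSet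
      ({s((0 : Site 3), BGN.up)} ∪ (withinGraph (zdGraph 3) BGN.upperHalfSpace).edgeSet) := by
  rw [Set.disjoint_left]
  intro e
  induction e using Sym2.ind with
  | h u v =>
    intro he he'
    rw [mem_edgeSet_withinGraph] at he
    rcases he' with he' | he'
    · rw [Set.mem_singleton_iff, Sym2.eq_iff] at he'
      rcases he' with ⟨rfl, rfl⟩ | ⟨rfl, rfl⟩
      · exact absurd he.2.2 (by simp)
      · exact absurd he.2.1 (by simp)
    · rw [mem_edgeSet_withinGraph] at he'
      have h1 : u 0 ≤ 0 := he.2.1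
      have h2 : 1 ≤ u 0 := he'.2.1
      omega

/-- **Two independent routes survive any single closure.** If `0 ↔ ∞ in {x₀ ≤ 0}`, the edge
`⟨0, e₀⟩` is open and `e₀ ↔ ∞ in {1 ≤ x₀}`, then for every edge `e` the origin still percolates in
`ω ∖ {e}`: a step `e` inside `{x₀ ≤ 0}` is neither `⟨0, e₀⟩` nor a step inside `{1 ≤ x₀}`, so the
second route survives its closure; any other `e` leaves the first route untouched. -/
private theorem twoRoutes_subset_backbone :
    percolatesVia (withinGraph (zdGraph 3) {x : Site 3 | x 0 ≤ 0}) (0 : Site 3) ∩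
        ({ω : BondConfig (Site 3) | s((0 : Site 3), BGN.up) ∈ ω} ∩
          percolatesVia (withinGraph (zdGraph 3) BGN.upperHalfSpace) BGN.up) ⊆
      {ω | ∀ e : Sym2 (Site 3), ω \ {e} ∈ percolatesAt (0 : Site 3)} := by
  rintro ω ⟨hA, hE, hB⟩
  rw [Set.mem_setOf_eq]
  intro e
  by_cases he : e ∈ (withinGraph (zdGraph 3) {x : Site 3 | x 0 ≤ 0}).edgeSet
  · -- `e` is a step inside `{x₀ ≤ 0}`: the route `0 — e₀ ↔ ∞ in {1 ≤ x₀}` survives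
    have he' : e ∉ ({s((0 : Site 3), BGN.up)} ∪ (withinGraph (zdGraph 3) BGN.upperHalfSpace).edgeSet) :=
      fun h => Set.disjoint_left.1 disjoint_edgeSet_lowerHalfSpace he h
    have hEe : s((0 : Site 3), BGN.up) ∈ ω \ {e} := by
      refine ⟨hE, fun h => he' (Or.inl ?_)⟩
      rw [Set.mem_singleton_iff] at h ⊢
      exact h.symm
    have hBe : ω \ {e} ∈ percolatesVia (withinGraph (zdGraph 3) BGN.upperHalfSpace) BGN.up :=
      diff_singleton_mem_of_determinedBy (determinedBy_percolatesVia _ _) (fun h => he' (Or.inr h)) hB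
    exact percolatesVia_subset_percolatesAt _ _
      (mem_percolatesVia_of_adj (withinGraph_le (zdGraph 3) BGN.upperHalfSpace)
        BGN.zdGraph_adj_zero_up hEe hBe)
  · -- otherwise the route `0 ↔ ∞ in {x₀ ≤ 0}` survives
    exact percolatesVia_subset_percolatesAt _ _
      (diff_singleton_mem_of_determinedBy (determinedBy_percolatesVia _ _) he hA)

/-- **`p · θ_ℍ(p)² ≤ Q(p)` — the easy half of the Chayes–Chayes backbone sandwich** (item
`stmt-CriticalPhenomena-10380`, exact route decl `BackboneAboveSurfaceSq`; Chayes–Chayes 1986,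
Thm. 4.4, vertex form; Grimmett 1999, §13.2): for every `p ∈ [0,1]`,
`p · θ_ℍ(p)² ≤ P_p{ω | ∀ e, ω ∖ {e} ∈ {|C(0)| = ∞}}`. The events `A = {0 ↔ ∞ in {x₀ ≤ 0}}`,
`E = {⟨0, e₀⟩ open}`, `B = {e₀ ↔ ∞ in {1 ≤ x₀}}` are independent (disjoint edge sets) of
probabilities `θ_ℍ(p)`, `p`, `θ_ℍ(p)`, and `A ∩ E ∩ B` lies in the backbone event
(`twoRoutes_subset_backbone`). -/
theorem backboneAboveSurfaceSq_proof :
    Summit.CriticalPhenomena.PercolationContinuityZ3.Theses.PercNecklaceBackbone.BackboneAboveSurfaceSq := by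
  unfold Summit.CriticalPhenomena.PercolationContinuityZ3.Theses.PercNecklaceBackbone.BackboneAboveSurfaceSq
  intro p
  -- the route's `θ_ℍ` is `theta (halfSpaceGraph 3) (halfSpaceOrigin 3)` of `HalfSpace.lean`
  have hθ : theta ((zdGraph 3).induce {x : Site 3 | 0 ≤ x 0}) ⟨0, Set.mem_setOf.mpr le_rfl⟩ p =
      theta (halfSpaceGraph 3) (halfSpaceOrigin 3) p := rfl
  rw [hθ]
  -- probabilities of the three events
  have hPA := real_percolatesVia_lowerHalfSpace p
  have hPB := BGN.real_percolatesVia_upperHalfSpace_up p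
  have hPE : (bondPercolation (zdGraph 3) p).real {ω : BondConfig (Site 3) | s((0 : Site 3), BGN.up) ∈ ω} = p :=
    bondPercolation_cylinder (zdGraph 3) p ((SimpleGraph.mem_edgeSet _).2 BGN.zdGraph_adj_zero_up)
  -- independence: the three events are determined by pairwise disjoint edge sets
  have hPEB : (bondPercolation (zdGraph 3) p).real
        ({ω : BondConfig (Site 3) | s((0 : Site 3), BGN.up) ∈ ω} ∩
          percolatesVia (withinGraph (zdGraph 3) BGN.upperHalfSpace) BGN.up) =
      (bondPercolation (zdGraph 3) p).real {ω : BondConfig (Site 3) | s((0 : Site 3), BGN.up) ∈ ω} *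
        (bondPercolation (zdGraph 3) p).real
          (percolatesVia (withinGraph (zdGraph 3) BGN.upperHalfSpace) BGN.up) :=
    bondPercolation_real_inter_of_disjoint (zdGraph 3) p
      (Set.disjoint_singleton_left.2 BGN.edge_zero_up_notMem) (BGN.determinedBy_mem_edge _)
      (determinedBy_percolatesVia _ _) (measurableSet_mem _) (measurableSet_percolatesVia _ _)
  have hPAEB : (bondPercolation (zdGraph 3) p).real
        (percolatesVia (withinGraph (zdGraph 3) {x : Site 3 | x 0 ≤ 0}) (0 : Site 3) ∩
          ({ω : BondConfig (Site 3) | s((0 : Site 3), BGN.up) ∈ ω} ∩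
            percolatesVia (withinGraph (zdGraph 3) BGN.upperHalfSpace) BGN.up)) =
      (bondPercolation (zdGraph 3) p).real
          (percolatesVia (withinGraph (zdGraph 3) {x : Site 3 | x 0 ≤ 0}) (0 : Site 3)) *
        (bondPercolation (zdGraph 3) p).real
          ({ω : BondConfig (Site 3) | s((0 : Site 3), BGN.up) ∈ ω} ∩
            percolatesVia (withinGraph (zdGraph 3) BGN.upperHalfSpace) BGN.up) :=
    bondPercolation_real_inter_of_disjoint (zdGraph 3) p disjoint_edgeSet_lowerHalfSpace
      (determinedBy_percolatesVia _ _)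
      (((BGN.determinedBy_mem_edge _).mono Set.subset_union_left).inter
        ((determinedBy_percolatesVia _ _).mono Set.subset_union_right))
      (measurableSet_percolatesVia _ _) ((measurableSet_mem _).inter (measurableSet_percolatesVia _ _))
  calc (p : ℝ) * theta (halfSpaceGraph 3) (halfSpaceOrigin 3) p ^ 2
      = (bondPercolation (zdGraph 3) p).real
          (percolatesVia (withinGraph (zdGraph 3) {x : Site 3 | x 0 ≤ 0}) (0 : Site 3) ∩
            ({ω : BondConfig (Site 3) | s((0 : Site 3), BGN.up) ∈ ω} ∩
              percolatesVia (withinGraph (zdGraph 3) BGN.upperHalfSpace) BGN.up)) := by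
        rw [hPAEB, hPEB, hPA, hPB, hPE]; ring
    _ ≤ (bondPercolation (zdGraph 3) p).real
          {ω | ∀ e : Sym2 (Site 3), ω \ {e} ∈ percolatesAt (0 : Site 3)} :=
        measureReal_mono twoRoutes_subset_backbone

end Summit.CriticalPhenomena.PercolationContinuityZ3.Theorems

end
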